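import Mathlib
import HarnessLib
import Literature.Analysis.Distribution.SchwartzLatticeSum
import Literature.Analysis.Calculus.TVSDerivSlope

/-!
# The lattice sum `f ↦ ∑_{ℓ ∈ L} f (x + ℓ)` is a continuous linear functional on Schwartz space

Topic `Analysis/Distribution`; namespace `Literature.Analysis.Distribution` (continuing
`SchwartzLatticeSum.lean`). For a discrete subgroup `L` of a finite-dimensional real normed space `E`,
a complete normed space `F` and a point `x : E`:

* `SchwartzMap.norm_apply_add_le_mul_sup_seminorm` — the quantitative decay estimate behind everything:
  `‖f (x + ℓ)‖ ≤ 2^k (1 + ‖x‖)^k · ((1 + ‖ℓ‖)^k)⁻¹ · sup_{m ≤ (k,0)} p_m(f)` for every `k`, where `p_m` are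
  the Schwartz seminorms (Mathlib `SchwartzMap.one_add_le_sup_seminorm_apply` + Peetre's inequality
  `one_add_norm_le_mul_one_add_norm_add` of `SchwartzLatticeSum.lean`) — this is the Weierstrass
  `M`-test majorant `∑_k (1+|k+x|)^{-n-δ} ≤ C_{n,δ,x} ∑_k (1+|k|)^{-n-δ}` in the proof of the Poisson
  summation formula [Grafakos2014, proof of Thm. 3.2.8];
* `summable_one_add_norm_pow_inv` — `∑_{ℓ ∈ L} (1 + ‖ℓ‖)^{-(rank L + 1)} < ∞`
  (`ZLattice.summable_norm_pow_inv`);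
* `SchwartzMap.tsum_norm_apply_add_le` — `∑_{ℓ} ‖f (x + ℓ)‖ ≤ C_{L,x} · sup_{m ≤ (k,0)} p_m(f)` with
  `k = rank L + 1`, a bound by finitely many Schwartz seminorms, uniform in `f`;
* `SchwartzMap.latticeSumCLM 𝕜 L x : 𝓢(E, F) →L[𝕜] F`, `f ↦ ∑' ℓ : L, f (x + ℓ)` — the **periodisation
  evaluated at `x` is a continuous linear functional on `𝓢(E, F)`** (Mathlib `SchwartzMap.mkCLMtoNormedSpace`
  fed with the previous bound), with `latticeSumCLM_apply`, `hasSum_apply_add_lattice`;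
* `HasDerivAt.tsum_schwartz_lattice` — **term-wise differentiation of lattice sums of a differentiable
  family of Schwartz functions**: if `s ↦ γ s : 𝕜 → 𝓢(E, F)` has derivative `γ'` at `s₀` in the Schwartz
  topology (Mathlib's `HasDerivAt` for the topological vector space `𝓢(E, F)`, cf.
  `Literature/Analysis/Calculus/TVSDerivSlope.lean`), then `s ↦ ∑_{ℓ} γ s (x + ℓ)` has derivative
  `∑_{ℓ} γ' (x + ℓ)` at `s₀` — one line from `HasDerivAt.clm_comp_tvs`.

All statements are routine consequences of the definition of the Schwartz seminorms; the estimate is the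
one displayed in [Grafakos2014, proof of Thm. 3.2.8] (there for `L = ℤⁿ` and polynomial decay
`(1+|x|)^{-n-δ}`; a Schwartz function has it for every exponent, with constant a Schwartz seminorm).
Motivation (nothing below depends on it): theta series `s ↦ ∑_{v ∈ L} (ω(g_s) Φ)(v)` attached to a
one-parameter family acting continuously on `𝓢` are differentiated term-wise by `HasDerivAt.tsum_schwartz_lattice`
once `s ↦ ω(g_s) Φ` is known to be differentiable in `𝓢` (HodgeCM PerL cell `pub-hodgecm`, lane "Weil theta
models / derivative machinery"; filed under the LEAN-IN-TREE rule by seat pv02-g9).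

## References

* L. Grafakos, *Classical Fourier Analysis*, 3rd ed., GTM 249 (2014), §3.2.3, Theorem 3.2.8 and its proof
  [Grafakos2014] (held text `book:grafakos2014-classical-fourier-analysis`, p0197).
-/

noncomputable section

open scoped SchwartzMap Topology
open Filter

namespace Literature.Analysis.Distribution

variable {𝕜 E F : Type*} [NormedAddCommGroup E] [NormedSpace ℝ E]
  [NormedAddCommGroup F] [NormedSpace ℝ F]

/-! ## 1. The decay estimate with an explicit Schwartz-seminorm constant -/

/-- **Pointwise decay of lattice translates, uniformly in `f`**: for `k : ℕ`, `x ℓ : E` and `f ∈ 𝓢(E, F)`,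
`‖f (x + ℓ)‖ ≤ 2^k (1 + ‖x‖)^k ((1 + ‖ℓ‖)^k)⁻¹ · sup_{m ≤ (k,0)} p_m(f)`.
[cite: Grafakos2014, proof of Thm. 3.2.8] -/
theorem SchwartzMap.norm_apply_add_le_mul_sup_seminorm (𝕜 : Type*) [NormedField 𝕜] [NormedSpace 𝕜 F]
    [SMulCommClass ℝ 𝕜 F] (k : ℕ) (f : 𝓢(E, F)) (x ℓ : E) :
    ‖f (x + ℓ)‖ ≤ 2 ^ k * (1 + ‖x‖) ^ k * ((1 + ‖ℓ‖) ^ k)⁻¹ *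
      (Finset.Iic (k, 0)).sup (schwartzSeminormFamily 𝕜 E F) f := by
  set S : ℝ := (Finset.Iic (k, 0)).sup (schwartzSeminormFamily 𝕜 E F) f with hS
  have hS0 : 0 ≤ S := apply_nonneg _ _
  -- Mathlib's weighted bound at the point `x + ℓ`, order-zero derivative
  have h := SchwartzMap.one_add_le_sup_seminorm_apply (𝕜 := 𝕜) (m := (k, 0)) (k := k) (n := 0)
    le_rfl le_rfl f (x + ℓ)
  rw [norm_iteratedFDeriv_zero] at h
  change (1 + ‖x + ℓ‖) ^ k * ‖f (x + ℓ)‖ ≤ 2 ^ k * S at h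
  -- Peetre: `(1 + ‖ℓ‖)^k ≤ (1 + ‖x‖)^k (1 + ‖x + ℓ‖)^k`
  have hP : (1 + ‖ℓ‖) ^ k ≤ (1 + ‖x‖) ^ k * (1 + ‖x + ℓ‖) ^ k := by
    rw [← mul_pow]
    exact pow_le_pow_left₀ (by positivity) (one_add_norm_le_mul_one_add_norm_add le_rfl) k
  have hℓ : 0 < (1 + ‖ℓ‖) ^ k := by positivity
  have hxℓ : 0 < (1 + ‖x + ℓ‖) ^ k := by positivity
  -- `‖f (x+ℓ)‖ ≤ 2^k S / (1+‖x+ℓ‖)^k ≤ 2^k S (1+‖x‖)^k / (1+‖ℓ‖)^k`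
  have h1 : ‖f (x + ℓ)‖ ≤ 2 ^ k * S * ((1 + ‖x + ℓ‖) ^ k)⁻¹ := by
    rw [← div_eq_mul_inv, le_div_iff₀ hxℓ, mul_comm]
    exact h
  have h2 : ((1 + ‖x + ℓ‖) ^ k)⁻¹ ≤ (1 + ‖x‖) ^ k * ((1 + ‖ℓ‖) ^ k)⁻¹ := by
    rw [← div_eq_mul_inv, le_div_iff₀ hℓ, inv_mul_le_iff₀ hxℓ]
    calc (1 + ‖ℓ‖) ^ k ≤ (1 + ‖x‖) ^ k * (1 + ‖x + ℓ‖) ^ k := hP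
      _ = (1 + ‖x + ℓ‖) ^ k * (1 + ‖x‖) ^ k := mul_comm _ _
  calc ‖f (x + ℓ)‖ ≤ 2 ^ k * S * ((1 + ‖x + ℓ‖) ^ k)⁻¹ := h1
    _ ≤ 2 ^ k * S * ((1 + ‖x‖) ^ k * ((1 + ‖ℓ‖) ^ k)⁻¹) :=
        mul_le_mul_of_nonneg_left h2 (by positivity)
    _ = 2 ^ k * (1 + ‖x‖) ^ k * ((1 + ‖ℓ‖) ^ k)⁻¹ * S := by ring

/-- **`∑_{ℓ ∈ L} (1 + ‖ℓ‖)^{-(rank L + 1)} < ∞`** for a discrete subgroup `L` of a finite-dimensional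
real normed space (`ZLattice.summable_norm_pow_inv`, comparing with `‖ℓ‖^{-k}` off `ℓ = 0`). [folklore] -/
theorem summable_one_add_norm_pow_inv [FiniteDimensional ℝ E] (L : Submodule ℤ E) [DiscreteTopology L] :
    Summable fun ℓ : L => ((1 + ‖(ℓ : E)‖) ^ (Module.finrank ℤ L + 1))⁻¹ := by
  set k : ℕ := Module.finrank ℤ L + 1 with hk
  have hs := ZLattice.summable_norm_pow_inv L k (by rw [hk]; exact Nat.lt_succ_self _)
  refine hs.of_norm_bounded_eventually (Filter.eventually_cofinite.2
    ((Set.finite_singleton (0 : L)).subset fun ℓ hℓ => ?_))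
  by_contra h0
  refine hℓ ?_
  have hpos : 0 < ‖(ℓ : E)‖ := norm_pos_iff.2 (by simpa using h0)
  rw [Real.norm_of_nonneg (by positivity)]
  change ((1 + ‖(ℓ : E)‖) ^ k)⁻¹ ≤ ‖(ℓ : E)‖⁻¹ ^ k
  rw [inv_pow]
  exact inv_anti₀ (pow_pos hpos k) (pow_le_pow_left₀ hpos.le (by linarith) k)

/-- The constant `C_{L,x} := 2^k (1 + ‖x‖)^k ∑_{ℓ ∈ L} (1 + ‖ℓ‖)^{-k}`, `k = rank L + 1`. [folklore] -/
def latticeSumConst [FiniteDimensional ℝ E] (L : Submodule ℤ E) [DiscreteTopology L] (x : E) : ℝ :=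
  2 ^ (Module.finrank ℤ L + 1) * (1 + ‖x‖) ^ (Module.finrank ℤ L + 1) *
    ∑' ℓ : L, ((1 + ‖(ℓ : E)‖) ^ (Module.finrank ℤ L + 1))⁻¹

/-- `0 ≤ C_{L,x}` (every factor of `latticeSumConst` is nonnegative). [folklore] -/
theorem latticeSumConst_nonneg [FiniteDimensional ℝ E] (L : Submodule ℤ E) [DiscreteTopology L] (x : E) :
    0 ≤ latticeSumConst L x := by
  unfold latticeSumConst
  refine mul_nonneg (by positivity) (tsum_nonneg fun ℓ => by positivity)

/-- **`∑_{ℓ ∈ L} ‖f (x + ℓ)‖ ≤ C_{L,x} · sup_{m ≤ (k,0)} p_m(f)`** (`k = rank L + 1`): the lattice sum of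
norms is bounded by finitely many Schwartz seminorms, uniformly in `f`. [folklore] -/
theorem SchwartzMap.tsum_norm_apply_add_le (𝕜 : Type*) [NormedField 𝕜] [NormedSpace 𝕜 F]
    [SMulCommClass ℝ 𝕜 F] [FiniteDimensional ℝ E] (L : Submodule ℤ E) [DiscreteTopology L]
    (x : E) (f : 𝓢(E, F)) :
    ∑' ℓ : L, ‖f (x + (ℓ : E))‖ ≤ latticeSumConst L x *
      (Finset.Iic (Module.finrank ℤ L + 1, 0)).sup (schwartzSeminormFamily 𝕜 E F) f := by
  set k : ℕ := Module.finrank ℤ L + 1 with hk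
  set S : ℝ := (Finset.Iic (k, 0)).sup (schwartzSeminormFamily 𝕜 E F) f with hS
  have hS0 : 0 ≤ S := apply_nonneg _ _
  have hw := summable_one_add_norm_pow_inv L
  have hb : ∀ ℓ : L, ‖f (x + (ℓ : E))‖ ≤
      2 ^ k * (1 + ‖x‖) ^ k * S * ((1 + ‖(ℓ : E)‖) ^ k)⁻¹ := fun ℓ => by
    have := SchwartzMap.norm_apply_add_le_mul_sup_seminorm 𝕜 k f x (ℓ : E)
    calc ‖f (x + (ℓ : E))‖ ≤ 2 ^ k * (1 + ‖x‖) ^ k * ((1 + ‖(ℓ : E)‖) ^ k)⁻¹ * S := this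
      _ = 2 ^ k * (1 + ‖x‖) ^ k * S * ((1 + ‖(ℓ : E)‖) ^ k)⁻¹ := by ring
  have hmaj : Summable fun ℓ : L => 2 ^ k * (1 + ‖x‖) ^ k * S * ((1 + ‖(ℓ : E)‖) ^ k)⁻¹ :=
    hw.mul_left _
  calc ∑' ℓ : L, ‖f (x + (ℓ : E))‖
      ≤ ∑' ℓ : L, 2 ^ k * (1 + ‖x‖) ^ k * S * ((1 + ‖(ℓ : E)‖) ^ k)⁻¹ :=
        (Summable.of_nonneg_of_le (fun _ => norm_nonneg _) hb hmaj).tsum_le_tsum hb hmaj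
    _ = 2 ^ k * (1 + ‖x‖) ^ k * S * ∑' ℓ : L, ((1 + ‖(ℓ : E)‖) ^ k)⁻¹ := tsum_mul_left
    _ = latticeSumConst L x * S := by rw [latticeSumConst, ← hk]; ring

/-! ## 2. The lattice-sum functional -/

section CLM

variable (𝕜 : Type*) [NormedField 𝕜] [NormedSpace 𝕜 F] [SMulCommClass ℝ 𝕜 F]
  [FiniteDimensional ℝ E] [CompleteSpace F] (L : Submodule ℤ E) [DiscreteTopology L] (x : E)

/-- **Vector-valued summability** of the lattice translates of a Schwartz function (complete `F`).
[folklore] -/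
theorem SchwartzMap.summable_apply_add_lattice (f : 𝓢(E, F)) :
    Summable fun ℓ : L => f (x + (ℓ : E)) :=
  (SchwartzMap.summable_norm_add_lattice L f x).of_norm

/-- **The lattice sum at `x` as a continuous linear functional** `𝓢(E, F) →L[𝕜] F`,
`f ↦ ∑' ℓ : L, f (x + ℓ)` (the periodisation of `f`, evaluated at `x`). [folklore] -/
def SchwartzMap.latticeSumCLM : 𝓢(E, F) →L[𝕜] F :=
  SchwartzMap.mkCLMtoNormedSpace (σ := RingHom.id 𝕜) (fun f => ∑' ℓ : L, f (x + (ℓ : E)))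
    (fun f g => by
      simpa using (SchwartzMap.summable_apply_add_lattice L x f).tsum_add
        (SchwartzMap.summable_apply_add_lattice L x g))
    (fun a f => by
      simpa using (SchwartzMap.summable_apply_add_lattice L x f).tsum_const_smul a)
    ⟨Finset.Iic (Module.finrank ℤ L + 1, 0), latticeSumConst L x, latticeSumConst_nonneg L x,
      fun f => (norm_tsum_le_tsum_norm (SchwartzMap.summable_norm_add_lattice L f x)).trans
        (SchwartzMap.tsum_norm_apply_add_le 𝕜 L x f)⟩

/-- Unfolding lemma: `latticeSumCLM 𝕜 L x f = ∑' ℓ, f (x + ℓ)` (definitional). [folklore] -/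
@[simp] theorem SchwartzMap.latticeSumCLM_apply (f : 𝓢(E, F)) :
    SchwartzMap.latticeSumCLM 𝕜 L x f = ∑' ℓ : L, f (x + (ℓ : E)) := rfl

/-- The lattice sum at the origin: `latticeSumCLM 𝕜 L 0 f = ∑' ℓ, f ℓ`. [folklore] -/
theorem SchwartzMap.latticeSumCLM_zero_apply (f : 𝓢(E, F)) :
    SchwartzMap.latticeSumCLM 𝕜 L 0 f = ∑' ℓ : L, f (ℓ : E) := by
  simp

/-- `HasSum (ℓ ↦ f (x + ℓ)) (latticeSumCLM 𝕜 L x f)`. [folklore] -/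
theorem SchwartzMap.hasSum_apply_add_lattice (f : 𝓢(E, F)) :
    HasSum (fun ℓ : L => f (x + (ℓ : E))) (SchwartzMap.latticeSumCLM 𝕜 L x f) :=
  (SchwartzMap.summable_apply_add_lattice L x f).hasSum

/-- **Operator-norm form of the bound**: `‖∑' ℓ, f (x + ℓ)‖ ≤ C_{L,x} · sup_{m ≤ (rank L + 1, 0)} p_m(f)`.
[folklore] -/
theorem SchwartzMap.norm_latticeSumCLM_apply_le (f : 𝓢(E, F)) :
    ‖SchwartzMap.latticeSumCLM 𝕜 L x f‖ ≤ latticeSumConst L x *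
      (Finset.Iic (Module.finrank ℤ L + 1, 0)).sup (schwartzSeminormFamily 𝕜 E F) f :=
  (norm_tsum_le_tsum_norm (SchwartzMap.summable_norm_add_lattice L f x)).trans
    (SchwartzMap.tsum_norm_apply_add_le 𝕜 L x f)

/-- **Continuity of the lattice sum in the Schwartz topology**: if `Φ_i → Φ` in `𝓢(E, F)` along a filter,
then `∑_{ℓ} Φ_i (x + ℓ) → ∑_{ℓ} Φ (x + ℓ)`. [folklore] -/
theorem SchwartzMap.tendsto_tsum_apply_add_lattice {ι : Type*} {l : Filter ι} {Φ : ι → 𝓢(E, F)}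
    {Φ₀ : 𝓢(E, F)} (h : Tendsto Φ l (𝓝 Φ₀)) :
    Tendsto (fun i => ∑' ℓ : L, Φ i (x + (ℓ : E))) l (𝓝 (∑' ℓ : L, Φ₀ (x + (ℓ : E)))) :=
  ((SchwartzMap.latticeSumCLM ℝ L x).continuous.tendsto Φ₀).comp h

end CLM

/-! ## 3. Term-wise differentiation of lattice sums -/

section Deriv

variable {𝕜 : Type*} [NontriviallyNormedField 𝕜] [NormedSpace 𝕜 F] [SMulCommClass ℝ 𝕜 F]
  [FiniteDimensional ℝ E] [CompleteSpace F] (L : Submodule ℤ E) [DiscreteTopology L] (x : E)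

/-- **Term-wise differentiation of a lattice sum of Schwartz functions.** If `γ : 𝕜 → 𝓢(E, F)` has
derivative `γ'` at `s₀` for the Schwartz topology (Mathlib's `HasDerivAt` in the topological vector space
`𝓢(E, F)`: `(s - s₀)⁻¹ • (γ s - γ s₀) → γ'` in every Schwartz seminorm), then
`s ↦ ∑_{ℓ ∈ L} γ s (x + ℓ)` has derivative `∑_{ℓ ∈ L} γ' (x + ℓ)` at `s₀`. [folklore] -/
theorem _root_.HasDerivAt.tsum_schwartz_lattice {γ : 𝕜 → 𝓢(E, F)} {γ' : 𝓢(E, F)} {s₀ : 𝕜}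
    (hγ : HasDerivAt γ γ' s₀) :
    HasDerivAt (fun s => ∑' ℓ : L, γ s (x + (ℓ : E))) (∑' ℓ : L, γ' (x + (ℓ : E))) s₀ := by
  simpa using hγ.clm_comp_tvs (SchwartzMap.latticeSumCLM 𝕜 L x)

/-- The same at the origin: `s ↦ ∑_{ℓ} γ s ℓ` has derivative `∑_{ℓ} γ' ℓ`. [folklore] -/
theorem _root_.HasDerivAt.tsum_schwartz_lattice_zero {γ : 𝕜 → 𝓢(E, F)} {γ' : 𝓢(E, F)} {s₀ : 𝕜}
    (hγ : HasDerivAt γ γ' s₀) :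
    HasDerivAt (fun s => ∑' ℓ : L, γ s (ℓ : E)) (∑' ℓ : L, γ' (ℓ : E)) s₀ := by
  simpa using hγ.tsum_schwartz_lattice L 0

/-- **Slope form** (for families given by difference quotients, e.g. `Φ ∘ e^{sX}`): if
`(s - s₀)⁻¹ • (γ s - γ s₀) → γ'` in `𝓢(E, F)` as `s → s₀`, `s ≠ s₀`, then the lattice sums satisfy
`(s - s₀)⁻¹ • (∑_ℓ γ s (x+ℓ) - ∑_ℓ γ s₀ (x+ℓ)) → ∑_ℓ γ' (x+ℓ)`. [folklore] -/
theorem SchwartzMap.tendsto_slope_tsum_apply_add_lattice {γ : 𝕜 → 𝓢(E, F)} {γ' : 𝓢(E, F)} {s₀ : 𝕜}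
    (hγ : Tendsto (fun s => (s - s₀)⁻¹ • (γ s - γ s₀)) (𝓝[≠] s₀) (𝓝 γ')) :
    Tendsto (fun s => (s - s₀)⁻¹ • (∑' ℓ : L, γ s (x + (ℓ : E)) - ∑' ℓ : L, γ s₀ (x + (ℓ : E))))
      (𝓝[≠] s₀) (𝓝 (∑' ℓ : L, γ' (x + (ℓ : E)))) := by
  have hs : slope γ s₀ = fun s => (s - s₀)⁻¹ • (γ s - γ s₀) := funext fun s => slope_def_module γ s₀ s
  have h : HasDerivAt γ γ' s₀ := by
    rw [Literature.Analysis.Calculus.TVSDeriv.hasDerivAt_iff_tendsto_slope_tvs, hs]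
    exact hγ
  have h2 := h.tsum_schwartz_lattice L x
  have hs2 : slope (fun s => ∑' ℓ : L, γ s (x + (ℓ : E))) s₀ =
      fun s => (s - s₀)⁻¹ • (∑' ℓ : L, γ s (x + (ℓ : E)) - ∑' ℓ : L, γ s₀ (x + (ℓ : E))) :=
    funext fun s => slope_def_module _ s₀ s
  rw [hasDerivAt_iff_tendsto_slope, hs2] at h2
  exact h2

end Deriv

end Literature.Analysis.Distribution

end
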